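import Summits.Ventures.PercRepro.ProfileGapMonoThresholdBase
import Summits.Ventures.PercRepro.ProfileGapMonoThresholdComplement
import Summits.Ventures.PercRepro.ProfileGapMonoThresholdTopClimb
import Summits.Ventures.PercRepro.ProfilePointedSplit
import Summits.Ventures.PercRepro.ProfileGapMonoThresholdNullityFourAll

/-!
# PercRepro — THE TOP THRESHOLD OF THE CO-RANK-`q` FAMILY AT NULLITY `≤ q − 1` IS THEOREM A'S UNIMODAL FORM,
AND THEOREM A'S UNIMODAL FORM IS A SUM OF PER-POINT INEQUALITIES (p5, gen 34; `proofs/P5-GM1.md` §46)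

At nullity `ν := #E − ρ(E) ≤ q − 2` the co-rank-`q` top threshold `(I_{ρ(E)−1})` is VACUOUS (a rank-`(q−1)` set with a
spanning complement has at most `ν < q − 1` points); at nullity `q − 1` it is, on the nose, the unimodal form of
p10's Theorem A at the level `q − 1`: `(n − q + 1)·P_{q−1} ≤ q·P_q` for the bi-independent counts `P_j = #biIndepSets`
(`thresholdIneq_of_card_eq_of_fact`, ThresholdBase, with `t = ρ(E) − 1`); at rank exactly `q` the top threshold is the
row `(q−1, q)`, trivial by `thresholdIneq_pred_iff` and `thresholdIneq_of_rk_le`.  So the co-rank-`q` top threshold on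
EVERY finite matroid of nullity `≤ q − 1` and rank `≥ q` — in particular the co-rank-`5` top threshold at nullity `≤ 4`
(OPEN (2) of §45) — rests on the single statement `BiIndepUnimodal α` (weaker than the named fact
`BiIndepDensityLogConcave`, which implies it through `biIndepDensity_mono_of_fact`).  And `BiIndepUnimodal` is the
SUM over the points `x ∈ E` of the per-point inequalities `out_k(x) ≤ in_{k+1}(x)` (`BiIndepPointed`): the double
countings `Σ_x out_k(x) = (n − k)·P_k` and `Σ_x in_{k+1}(x) = (k + 1)·P_{k+1}` (`sum_outCount`, `sum_inCount`).
Both `BiIndepUnimodal` and `BiIndepPointed` are CONJECTURE defs (NOT asserted; 0 violations on every matroid with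
`≤ 9` elements, §46(b)).  Nothing open is asserted.

* `thresholdIneq_top_of_card_add_two_le` (nullity `≤ q − 2`: vacuous), `thresholdIneq_top_of_rk_eq` (rank `q`: trivial);
* `BiIndepUnimodal` (conjecture def), `biIndepUnimodal_of_fact`, `thresholdIneq_of_card_eq_of_unimodal`;
* **`thresholdIneq_top_of_nullity_le_pred_of_unimodal`**, `thresholdIneq_top_of_nullity_le_pred_of_fact`,
  `thresholdIneq_five_top_of_nullity_le_four_of_unimodal`;
* `sum_inCount`, `sum_outCount`, `BiIndepPointed` (conjecture def), **`biIndepUnimodal_of_pointed`**,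
  `thresholdIneq_top_of_nullity_le_pred_of_pointed`;
* THE CONVERSE, UNCONDITIONAL: `biIndep_step_of_thresholdIneq_top` (the co-rank-`q` top threshold at nullity
  `q − 1` IS the step `(n − q + 1)·P_{q−1} ≤ q·P_q`), hence Theorem A's unimodal form is a KERNEL THEOREM at the
  bottom level `j = ν` for `ν ≤ 3`: **`biIndep_step_one_of_nullity_one`**, **`biIndep_step_two_of_nullity_two`**,
  **`biIndep_step_three_of_nullity_three`** (from `thresholdIneq_two`, `thresholdIneq_three_all`,
  `thresholdIneq_four_top_of_nullity_le_four`).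
-/

open scoped Matroid

namespace PercRepro.Cogirth

open Finset ThmH Skew Shadow Profile

variable {α : Type} [DecidableEq α]

section Vacuous

variable {N : Matroid α} [N.Finite] {q : ℕ}

/-- **At nullity `≤ q − 2` the top threshold of the co-rank-`q` family is vacuous**: a rank-`(q−1)` set whose
complement has rank `ρ(E)` has at least `ρ(E)` points outside it, hence at most `#E − ρ(E) ≤ q − 2 < q − 1` points of
its own.  (The case `q = 4` is `thresholdIneq_four_top_of_nullity_le_two`.) -/
theorem thresholdIneq_top_of_card_add_two_le (hq : 2 ≤ q) (hn : (gr N).card + 2 ≤ rk N (gr N) + q) :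
    ThresholdIneq N q (rk N (gr N) - 1) := by
  unfold ThresholdIneq thresholdSum
  have hzero : ∀ B ∈ Rq N (q - 1),
      (if rk N (gr N) - 1 + 1 ≤ rk N (gr N \ B) then rk N (gr N \ B) else 0) = 0 := by
    intro B hB
    rw [if_neg]
    have hBg : B ⊆ gr N := (mem_Rq.1 hB).1
    have hBr : rk N B = q - 1 := rk_eq_of_eRk_eq (mem_Rq.1 hB).2
    have hBc : rk N B ≤ B.card := rk_le_card' B
    have hBE : rk N B ≤ rk N (gr N) := rk_mono' hBg
    have h1 := card_sdiff_add_card_eq_card hBg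
    have h2 : rk N (gr N \ B) ≤ (gr N \ B).card := rk_le_card' _
    omega
  rw [sum_congr rfl hzero, sum_const_zero]
  exact Nat.zero_le _

/-- **At rank `q` the top threshold `t = q − 1` is the row `(q−1, q)`, trivial on every matroid**
(`thresholdIneq_pred_iff` and the vacuous `(I_q)` at rank `q`; §42(d)). -/
theorem thresholdIneq_top_of_rk_eq (hq : 1 ≤ q) (hR : rk N (gr N) = q) :
    ThresholdIneq N q (rk N (gr N) - 1) := by
  rw [hR]
  exact (thresholdIneq_pred_iff hq).2 (thresholdIneq_of_rk_le (by rw [hR]))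

end Vacuous

section Unimodal

/-- **THE UNIMODAL FORM OF THEOREM A** (a `Prop`; a CONJECTURE, NOT asserted): for every finite matroid on `n` points
and every `j` with `2j + 2 ≤ n`, `(n − j)·P_j ≤ (j + 1)·P_{j+1}` — the bi-independent density `P_j / C(n, j)` does not
decrease below the middle.  Implied by the named fact `BiIndepDensityLogConcave` (`biIndepUnimodal_of_fact`);
0 violations on every matroid with `≤ 9` elements (§46(b)). -/
def BiIndepUnimodal (α : Type) [DecidableEq α] : Prop :=
  ∀ (N : Matroid α) [N.Finite] (j : ℕ), 2 * j + 2 ≤ (gr N).card →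
    ((gr N).card - j) * (biIndepSets N j).card ≤ (j + 1) * (biIndepSets N (j + 1)).card

/-- The named fact implies the unimodal form (p10's `biIndepDensity_mono_of_fact`). -/
theorem biIndepUnimodal_of_fact (hfact : BiIndepDensityLogConcave α) : BiIndepUnimodal α := by
  intro N _ j hj
  exact biIndepDensity_mono_of_fact hfact N j hj

variable {N : Matroid α} [N.Finite] {q t : ℕ}

/-- `(I_t)` on its minimal ground sets `#E = t + q` (`1 ≤ q ≤ t`) from the unimodal form alone
(the proof of `thresholdIneq_of_card_eq_of_fact` with the weaker hypothesis). -/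
theorem thresholdIneq_of_card_eq_of_unimodal (hu : BiIndepUnimodal α) (hq : 1 ≤ q) (hqt : q ≤ t)
    (hn : (gr N).card = t + q) : ThresholdIneq N q t := by
  unfold ThresholdIneq
  rw [thresholdSum_of_card_eq hn hq, levelSetCoQ_eq_biIndepSets_of_card_eq hn]
  have h := hu N (q - 1) (by omega)
  have e1 : (gr N).card - (q - 1) = t + 1 := by omega
  have e2 : q - 1 + 1 = q := by omega
  rw [e1, e2] at h
  exact h

/-- **THE TOP THRESHOLD OF THE CO-RANK-`q` FAMILY ON EVERY FINITE MATROID OF NULLITY `≤ q − 1` AND RANK `≥ q`,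
MODULO THE UNIMODAL FORM OF THEOREM A**: nullity `≤ q − 2` is vacuous, rank `q` is the trivial row, and nullity
exactly `q − 1` at rank `≥ q + 1` is `(n − q + 1)·P_{q−1} ≤ q·P_q` on the nose. -/
theorem thresholdIneq_top_of_nullity_le_pred_of_unimodal (hu : BiIndepUnimodal α) (hq : 2 ≤ q)
    (hn : (gr N).card ≤ rk N (gr N) + (q - 1)) (hR : q ≤ rk N (gr N)) :
    ThresholdIneq N q (rk N (gr N) - 1) := by
  by_cases hlow : (gr N).card + 2 ≤ rk N (gr N) + q
  · exact thresholdIneq_top_of_card_add_two_le hq hlow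
  · have hn' : (gr N).card = (rk N (gr N) - 1) + q := by omega
    by_cases hRq : rk N (gr N) = q
    · exact thresholdIneq_top_of_rk_eq (by omega) hRq
    · exact thresholdIneq_of_card_eq_of_unimodal hu (by omega) (by omega) hn'

/-- The same modulo the named fact `BiIndepDensityLogConcave`. -/
theorem thresholdIneq_top_of_nullity_le_pred_of_fact (hfact : BiIndepDensityLogConcave α) (hq : 2 ≤ q)
    (hn : (gr N).card ≤ rk N (gr N) + (q - 1)) (hR : q ≤ rk N (gr N)) :
    ThresholdIneq N q (rk N (gr N) - 1) :=
  thresholdIneq_top_of_nullity_le_pred_of_unimodal (biIndepUnimodal_of_fact hfact) hq hn hR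

/-- **OPEN (2) of §45 identified**: the co-rank-`5` top threshold on every finite matroid with at most four more points
than its rank (rank `≥ 5`) is Theorem A's unimodal form at the level `4`. -/
theorem thresholdIneq_five_top_of_nullity_le_four_of_unimodal (hu : BiIndepUnimodal α)
    (hn : (gr N).card ≤ rk N (gr N) + 4) (hR : 5 ≤ rk N (gr N)) :
    ThresholdIneq N 5 (rk N (gr N) - 1) :=
  thresholdIneq_top_of_nullity_le_pred_of_unimodal hu (by norm_num) hn hR

end Unimodal

section Pointed

variable {N : Matroid α} [N.Finite]

/-- `Σ_{x ∈ E} in_k(x) = k · P_k`: every bi-independent `k`-set is counted once per point it contains. -/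
theorem sum_inCount (N : Matroid α) [N.Finite] (k : ℕ) :
    ∑ x ∈ gr N, inCount N k x = k * (biIndepSets N k).card := by
  unfold inCount
  have h := sum_card_bipartiteAbove_eq_sum_card_bipartiteBelow (r := fun (x : α) (X : Finset α) => x ∈ X)
    (s := gr N) (t := biIndepSets N k)
  simp only [bipartiteAbove, bipartiteBelow] at h
  rw [h]
  have hc : ∀ X ∈ biIndepSets N k, ((gr N).filter (fun x => x ∈ X)).card = k := by
    intro X hX
    rw [mem_biIndepSets] at hX
    obtain ⟨hXg, hXk, _, _⟩ := hX
    rw [filter_mem_eq_inter, inter_eq_right.2 hXg, hXk]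
  rw [sum_congr rfl hc, sum_const, smul_eq_mul, Nat.mul_comm]

/-- `Σ_{x ∈ E} out_k(x) = (n − k) · P_k`: every bi-independent `k`-set is counted once per point it misses. -/
theorem sum_outCount (N : Matroid α) [N.Finite] (k : ℕ) :
    ∑ x ∈ gr N, outCount N k x = ((gr N).card - k) * (biIndepSets N k).card := by
  unfold outCount
  have h := sum_card_bipartiteAbove_eq_sum_card_bipartiteBelow (r := fun (x : α) (X : Finset α) => x ∉ X)
    (s := gr N) (t := biIndepSets N k)
  simp only [bipartiteAbove, bipartiteBelow] at h
  rw [h]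
  have hc : ∀ X ∈ biIndepSets N k, ((gr N).filter (fun x => x ∉ X)).card = (gr N).card - k := by
    intro X hX
    rw [mem_biIndepSets] at hX
    obtain ⟨hXg, hXk, _, _⟩ := hX
    rw [filter_not, filter_mem_eq_inter, inter_eq_right.2 hXg, card_sdiff_of_subset hXg, hXk]
  rw [sum_congr rfl hc, sum_const, smul_eq_mul, Nat.mul_comm]

/-- **THE PER-POINT FORM OF THEOREM A** (a `Prop`; a CONJECTURE, NOT asserted): for every finite matroid, every
point `x` and every `k` with `2k + 2 ≤ n`, `out_k(x) ≤ in_{k+1}(x)` — among the bi-independent sets, those of size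
`k` avoiding `x` are at most those of size `k + 1` containing `x` (the map `W ↦ W ∪ x` misses exactly the `W`
with `x ∈ cl W`, and is missed exactly by the `W'` with `x ∈ cl(E ∖ W')`).  0 violations on every matroid with
`≤ 9` elements (§46(b)); its sum over `x` is `BiIndepUnimodal` (`biIndepUnimodal_of_pointed`). -/
def BiIndepPointed (α : Type) [DecidableEq α] : Prop :=
  ∀ (N : Matroid α) [N.Finite] (x : α) (k : ℕ), x ∈ gr N → 2 * k + 2 ≤ (gr N).card →
    outCount N k x ≤ inCount N (k + 1) x

/-- **The per-point form implies the unimodal form**: sum `out_k(x) ≤ in_{k+1}(x)` over the points. -/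
theorem biIndepUnimodal_of_pointed (h : BiIndepPointed α) : BiIndepUnimodal α := by
  intro N _ j hj
  rw [← sum_outCount, ← sum_inCount]
  exact sum_le_sum (fun x hx => h N x j hx hj)

/-- The co-rank-`q` top threshold at nullity `≤ q − 1`, modulo the per-point form. -/
theorem thresholdIneq_top_of_nullity_le_pred_of_pointed (h : BiIndepPointed α) {q : ℕ} (hq : 2 ≤ q)
    (hn : (gr N).card ≤ rk N (gr N) + (q - 1)) (hR : q ≤ rk N (gr N)) :
    ThresholdIneq N q (rk N (gr N) - 1) :=
  thresholdIneq_top_of_nullity_le_pred_of_unimodal (biIndepUnimodal_of_pointed h) hq hn hR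

end Pointed

section BottomLevels

variable {N : Matroid α} [N.Finite]

/-- **The converse bridge**: on `#E = ρ(E) + q − 1` (`1 ≤ q`, `1 ≤ ρ(E)`) the co-rank-`q` top threshold is exactly the step
`(n − (q − 1))·P_{q−1} ≤ q·P_q` of Theorem A's unimodal form at the bottom level `j = q − 1 = ν`. -/
theorem biIndep_step_of_thresholdIneq_top {q : ℕ} (hq : 1 ≤ q) (hR : 1 ≤ rk N (gr N))
    (hn : (gr N).card = rk N (gr N) + (q - 1)) (h : ThresholdIneq N q (rk N (gr N) - 1)) :
    ((gr N).card - (q - 1)) * (biIndepSets N (q - 1)).card ≤ q * (biIndepSets N q).card := by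
  have hn' : (gr N).card = (rk N (gr N) - 1) + q := by omega
  unfold ThresholdIneq at h
  rw [thresholdSum_of_card_eq hn' hq, levelSetCoQ_eq_biIndepSets_of_card_eq hn'] at h
  have e1 : rk N (gr N) - 1 + 1 = (gr N).card - (q - 1) := by omega
  rw [e1] at h
  exact h

/-- **Theorem A's unimodal form at the level `1` is a theorem on every matroid of nullity `1`** (from the co-rank-`2`
family, `thresholdIneq_two`): `(n − 1)·P_1 ≤ 2·P_2` when `#E = ρ(E) + 1` and `ρ(E) ≥ 2`. -/
theorem biIndep_step_one_of_nullity_one (hn : (gr N).card = rk N (gr N) + 1) (hR : 2 ≤ rk N (gr N)) :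
    ((gr N).card - 1) * (biIndepSets N 1).card ≤ 2 * (biIndepSets N 2).card :=
  biIndep_step_of_thresholdIneq_top (q := 2) (by norm_num) (by omega) hn (thresholdIneq_two N (by omega))

/-- **Theorem A's unimodal form at the level `2` is a theorem on every matroid of nullity `2`** (from the co-rank-`3`
family, `thresholdIneq_three_all`): `(n − 2)·P_2 ≤ 3·P_3` when `#E = ρ(E) + 2` and `ρ(E) ≥ 3`. -/
theorem biIndep_step_two_of_nullity_two (hn : (gr N).card = rk N (gr N) + 2) (hR : 3 ≤ rk N (gr N)) :
    ((gr N).card - 2) * (biIndepSets N 2).card ≤ 3 * (biIndepSets N 3).card :=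
  biIndep_step_of_thresholdIneq_top (q := 3) (by norm_num) (by omega) hn (thresholdIneq_three_all N (by omega))

/-- **Theorem A's unimodal form at the level `3` is a theorem on every matroid of nullity `3`** (from the co-rank-`4`
top threshold at nullity `≤ 4`, `thresholdIneq_four_top_of_nullity_le_four`): `(n − 3)·P_3 ≤ 4·P_4` when
`#E = ρ(E) + 3` and `ρ(E) ≥ 4` — the first level at which Theorem A is not otherwise in the kernel. -/
theorem biIndep_step_three_of_nullity_three (hn : (gr N).card = rk N (gr N) + 3) (hR : 4 ≤ rk N (gr N)) :
    ((gr N).card - 3) * (biIndepSets N 3).card ≤ 4 * (biIndepSets N 4).card :=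
  biIndep_step_of_thresholdIneq_top (q := 4) (by norm_num) (by omega) hn
    (thresholdIneq_four_top_of_nullity_le_four N (by omega) hR)

end BottomLevels

end PercRepro.Cogirth
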